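import Summits.HodgeConjecture.HodgeConjecture.Theses.AnchorTransport
import Summits.HodgeConjecture.HodgeConjecture.Theorems.QbarEnvelopeEnvelopeStubNumberFieldModel
import Literature.AlgebraicGeometry.HodgeTheory.SpreadingOutQbarFamilyProofs
import Literature.AlgebraicGeometry.HodgeTheory.QbarFamilyLocalSystem
import Literature.AlgebraicGeometry.HodgeTheory.AlgebraicCyclesDefinedOverQbar
import Literature.AlgebraicGeometry.HodgeTheory.AlgebraicCyclesDefinedOverQbarSpread
import HarnessLib

/-!
# Route AnchorTransport — `AnchorExistence` (stmt-HodgeConjecture-1077), line `qbar-fibre-anchors`: stub `stub_definable_of_rigid`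

The registered stub `stub_definable_of_rigid` (stub 2, "descent of rigid varieties") of the line
skeleton `Cruxes/AnchorExistence/Lines/qbar_fibre_anchors.lean`, proved UNCONDITIONALLY.

**Statement.** Let `X` be a smooth projective complex variety of dimension `n` which is
*extrinsically rigid*: for every smooth projective family `f : 𝒳 ⟶ S` of relative dimension `n`
over a smooth irreducible complex base and complex points `s₁, s₀ ∈ S(ℂ)`, `X ≅ 𝒳_{s₁}` implies
`X ≅ 𝒳_{s₀}`. Then `X` is definable over a number field: `X ≅ X₀ ⊗_{K,σ} ℂ` for a number field `K`,
an embedding `σ : K →+* ℂ` and a `K`-scheme `X₀`.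

**Proof** (the printed argument: Voisin, *Hodge loci and absolute Hodge classes*, §3, first
paragraph of the proof of Prop. 1.2 — spread `X` out over `ℚ̄`; here every complex fibre is `≅ X`, so
a `ℚ̄`-point of the base gives the model).
1. Fix `σ : ℚ̄ →+* ℂ` and spread `X` out (the tree's PROVED
   `spreadingOut_smoothProjective_qbarFamily_holds`): `X ≅ 𝒳_s`, the fibre over a complex point `s`
   of the complexification `F = f₀ ⊗_σ ℂ` of a `ℚ̄`-morphism `f₀ : 𝒳₀ ⟶ S₀` of quasi-projective
   `ℚ̄`-schemes, `S₀` smooth irreducible, `F` a smooth projective family of relative dimension `n`.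
2. The complexified base `S₀ ⊗_σ ℂ` is smooth (base change) and irreducible (`ℚ̄` is algebraically
   closed: `irreducibleSpace_baseChangeHom_left`).
3. `S₀` has a `ℚ̄`-rational point `w` (Nullstellensatz, `exists_ratPoint_pt_mem_of_isOpen`), and
   there is a complex point `t` of `S₀ ⊗_σ ℂ` over it (`exists_algPoint_baseChangeHom_over`).
4. The fibre of `F` over `t` is the complexification of the `ℚ̄`-fibre `Y₀ = (𝒳₀)_w`: both are the
   fibre product of `f₀` with `Spec ℂ → Spec ℚ̄ → S₀` (pasting of cartesian squares,
   `fiberOver_baseChangeHom_iso_of_over`).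
5. Rigidity applied to `F`, `s`, `t`: `X ≅ 𝒳_t ≅ Y₀ ⊗_σ ℂ`.
6. `Y₀` is smooth projective over `ℚ̄` (descent along `σ`, the tree's PROVED
   `isSmoothProjective_of_baseChangeHom`), hence it has a model `Y₁` over a number field
   `K = ℚ(t₀) ⊆ ℚ̄` (an integral closed subscheme of `ℙᴺ_{ℚ̄}` descends to a subfield generated by
   finitely many algebraic numbers, Görtz–Wedhorn I Prop. 10.75 — the tree's PROVED
   `Theorems.stub_numberFieldModel`, stub of the sibling crux stmt-HodgeConjecture-1069).
7. Transitivity of base change: `X ≅ (Y₁ ⊗_K ℚ̄) ⊗_σ ℂ ≅ Y₁ ⊗_{K, σ ∘ ι} ℂ` (Mathlib `Over.pullbackComp`).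

Everything used is proved in the tree or in Mathlib; no named fact is assumed.

## References

* C. Voisin, Hodge loci and absolute Hodge classes, Compos. Math. 143 (2007), §3, proof of
  Prop. 1.2, first paragraph. [Voisin2007HodgeLoci]
* F. Charles, C. Schnell, Notes on absolute Hodge classes (2014), §11.3.5. [CharlesSchnell2014Notes]
* U. Görtz, T. Wedhorn, Algebraic Geometry I, 2nd ed. (2020), Prop. 10.75 and (10.13). [GortzWedhorn2020]
* R. Hartshorne, Algebraic Geometry (1977), II.3 (fibres and base extension). [Hartshorne1977]
-/

noncomputable section

-- every declaration of this problem lives in `Summit.HodgeConjecture.HodgeConjecture.…` (summit = sub-problem)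
set_option linter.dupNamespace false
-- Mathlib's pull-back / `Over` API is stated through `abbrev`s over `limit` and `Over.mk`; as in Mathlib's own
-- algebraic-geometry files (and the tree's `SpreadingOutQbarFamilyProofs`) we let `rw`/unification see through them.
set_option backward.isDefEq.respectTransparency false

open CategoryTheory CategoryTheory.Limits AlgebraicGeometry
open Literature.AlgebraicGeometry Literature.AlgebraicGeometry.Motives
  Literature.AlgebraicGeometry.HodgeTheory

namespace Summit.HodgeConjecture.HodgeConjecture.Theorems.QbarFibreAnchors

universe u

/-- **The fibre of a complexified family over a point lying over a rational point is the
complexification of the rational fibre.** For `σ : K →+* L`, a `K`-morphism `f₀ : 𝒳₀ ⟶ S₀`, a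
rational point `w ∈ S₀(K)` and an `L`-point `t` of `S₀ ⊗_σ L` lying over `w`
(`t ≫ π = Spec σ ≫ w`), the fibre of `f₀ ⊗_σ L` over `t` is `L`-isomorphic to `(𝒳₀)_w ⊗_σ L`:
both are the fibre product of `f₀` with `Spec L → Spec K → S₀` (pasting the fibre square of
`f₀ ⊗_σ L` over `t` with the base-change square of `f₀`, resp. the base-change square of `(𝒳₀)_w`
with the fibre square of `f₀` over `w`; Hartshorne II.3, Thm. 3.3 and p. 89). [folklore] -/
theorem fiberOver_baseChangeHom_iso_of_over {K L : Type u} [Field K] [Field L] (σ : K →+* L)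
    {𝒳₀ S₀ : SchemeOver K} (f₀ : 𝒳₀ ⟶ S₀) (w : AlgPoints S₀ K)
    (t : AlgPoints ((baseChangeHom σ).obj S₀) L)
    (ht : t.left ≫ baseChangeHomFst σ S₀ = Spec.map (CommRingCat.ofHom σ) ≫ w.left) :
    Nonempty (fiberOver ((baseChangeHom σ).map f₀) t ≅ (baseChangeHom σ).obj (fiberOver f₀ w)) := by
  -- the fibre of `f₀ ⊗_σ L` over `t` is cartesian over `f₀` along `Spec L → Spec K → S₀`
  have HL : IsPullback
      (pullback.fst ((baseChangeHom σ).map f₀).left t.left ≫ baseChangeHomFst σ 𝒳₀)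
      (fiberOver ((baseChangeHom σ).map f₀) t).hom f₀.left
      (Spec.map (CommRingCat.ofHom σ) ≫ w.left) := by
    rw [fiberOver_hom, SpreadingOutQbar.specOver_self_hom, Category.comp_id, ← ht]
    exact (IsPullback.of_hasPullback _ _).paste_horiz
      (SpreadingOutQbar.isPullback_baseChangeHom_map_left σ f₀)
  -- so is the base change of the rational fibre `(𝒳₀)_w`
  have hY : (fiberOver f₀ w).hom = pullback.snd f₀.left w.left := by
    rw [fiberOver_hom, SpreadingOutQbar.specOver_self_hom, Category.comp_id]
  have sq : IsPullback (baseChangeHomFst σ (fiberOver f₀ w))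
      ((baseChangeHom σ).obj (fiberOver f₀ w)).hom (pullback.snd f₀.left w.left)
      (Spec.map (CommRingCat.ofHom σ)) := by
    rw [← hY]
    exact IsPullback.of_hasPullback _ _
  have HR : IsPullback (baseChangeHomFst σ (fiberOver f₀ w) ≫ pullback.fst f₀.left w.left)
      ((baseChangeHom σ).obj (fiberOver f₀ w)).hom f₀.left
      (Spec.map (CommRingCat.ofHom σ) ≫ w.left) :=
    sq.paste_horiz (IsPullback.of_hasPullback f₀.left w.left)
  exact ⟨Over.isoMk (HL.isoIsPullback _ _ HR) (HL.isoIsPullback_hom_snd _ _ HR)⟩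

/-- **Transitivity of base change**: `(X_φ)_σ ≅ X_{σ ∘ φ}` for `φ : k →+* L`, `σ : L →+* M`
(Mathlib `Over.pullbackComp` and `Spec (σ ∘ φ) = Spec σ ≫ Spec φ`; Hartshorne II.3). [folklore] -/
theorem iso_baseChangeHom_comp_of_rigid {k L M : Type u} [CommRing k] [CommRing L] [CommRing M]
    (φ : k →+* L) (σ : L →+* M) (X : SchemeOver k) :
    Nonempty ((baseChangeHom σ).obj ((baseChangeHom φ).obj X) ≅ (baseChangeHom (σ.comp φ)).obj X) := by
  have h : Spec.map (CommRingCat.ofHom (σ.comp φ)) =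
      Spec.map (CommRingCat.ofHom σ) ≫ Spec.map (CommRingCat.ofHom φ) := by
    rw [CommRingCat.ofHom_comp, Spec.map_comp]
  refine ⟨((CategoryTheory.Over.pullbackComp (Spec.map (CommRingCat.ofHom σ))
      (Spec.map (CommRingCat.ofHom φ))).app X).symm ≪≫ CategoryTheory.eqToIso ?_⟩
  change (CategoryTheory.Over.pullback _).obj X = (CategoryTheory.Over.pullback _).obj X
  rw [h]

/-- **Stub `stub_definable_of_rigid` (descent of extrinsically rigid varieties), proved.** An
extrinsically rigid smooth projective complex variety is definable over a number field: spread `X`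
out over a smooth irreducible `ℚ̄`-variety (Voisin 2007, §3, proof of Prop. 1.2; Charles–Schnell
§11.3.5 — the tree's `spreadingOut_smoothProjective_qbarFamily_holds`); by rigidity every complex
fibre of the spread is `≅ X`, in particular the fibre over a complex point lying over a `ℚ̄`-point
`w` of the base (Nullstellensatz), which is the complexification of the `ℚ̄`-fibre over `w`
(`fiberOver_baseChangeHom_iso_of_over`); that `ℚ̄`-fibre is smooth projective (descent,
`isSmoothProjective_of_baseChangeHom`), hence defined over a number field
(`Theorems.stub_numberFieldModel`, Görtz–Wedhorn I Prop. 10.75), and base change is transitive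
(`iso_baseChangeHom_comp_of_rigid`).
[cite: Voisin2007HodgeLoci, §3, proof of Prop. 1.2, first paragraph (arXiv math/0605766 p. 6)]
[cite: CharlesSchnell2014Notes, §11.3.5 (paragraph before Thm. 11.3.17)] -/
theorem stub_definable_of_rigid :
    ∀ ⦃n : ℕ⦄ ⦃X : SchemeOver ℂ⦄, IsSmoothProjective n X →
      (∀ ⦃𝒳 S : SchemeOver ℂ⦄ (f : 𝒳 ⟶ S) (s₁ s₀ : ComplexPoints S),
        IsSmoothProjectiveFamily f n → IrreducibleSpace S.left → AlgebraicGeometry.Smooth S.hom →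
        Nonempty (X ≅ fiberOver f s₁) → Nonempty (X ≅ fiberOver f s₀)) →
      ∃ (K : Type) (_ : Field K) (_ : NumberField K) (σ : K →+* ℂ) (X₀ : SchemeOver K),
        Nonempty (X ≅ (baseChangeHom σ).obj X₀) := by
  intro n X hX hrig
  -- an embedding `σ : ℚ̄ →+* ℂ` and a spread of `X` over `ℚ̄`
  obtain ⟨σ⟩ := exists_ringHom_algebraicClosure_rat_complex
  obtain ⟨𝒳₀, S₀, f₀, s, -, hS₀, hirr, hsm, hf, -, hXs⟩ :=
    spreadingOut_smoothProjective_qbarFamily_holds σ hX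
  haveI := hirr
  haveI := hsm
  -- the complexified base is smooth and irreducible
  haveI : IrreducibleSpace ((baseChangeHom σ).obj S₀).left := irreducibleSpace_baseChangeHom_left σ
  have hsm' : AlgebraicGeometry.Smooth ((baseChangeHom σ).obj S₀).hom := smooth_baseChangeHom_hom σ
  -- a `ℚ̄`-point `w` of the base and a complex point `t` over it
  haveI : LocallyOfFiniteType S₀.hom := locallyOfFiniteType_of_isQuasiProjectiveOver hS₀
  obtain ⟨w, -⟩ := exists_ratPoint_pt_mem_of_isOpen S₀ isOpen_univ
    ⟨(baseChangeHomFst σ S₀).base s.pt, Set.mem_univ _⟩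
  obtain ⟨t, ht⟩ := exists_algPoint_baseChangeHom_over σ S₀ w
  -- rigidity: `X ≅ 𝒳_t`, and `𝒳_t ≅ (𝒳₀)_w ⊗_σ ℂ`
  obtain ⟨e⟩ := hrig ((baseChangeHom σ).map f₀) s t hf inferInstance hsm' hXs
  obtain ⟨e'⟩ := fiberOver_baseChangeHom_iso_of_over σ f₀ w t ht
  -- `(𝒳₀)_w` is smooth projective over `ℚ̄`, hence has a model over a number field
  have hY : IsSmoothProjective n (fiberOver f₀ w) :=
    isSmoothProjective_of_baseChangeHom σ (fiberOver f₀ w) ((hf.isSmoothProjective t).of_iso e')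
  obtain ⟨K, hK, hKn, ι, W₁, ⟨e₁⟩⟩ := stub_numberFieldModel (fiberOver f₀ w) hY
  obtain ⟨e₂⟩ := iso_baseChangeHom_comp_of_rigid ι σ W₁
  exact ⟨K, hK, hKn, σ.comp ι, W₁, ⟨e ≪≫ e' ≪≫ (baseChangeHom σ).mapIso e₁ ≪≫ e₂⟩⟩

end Summit.HodgeConjecture.HodgeConjecture.Theorems.QbarFibreAnchors

end
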